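import Summits.QuantumFields.YangMills.Theses.ColdBoxAllGroups
import Summits.QuantumFields.YangMills.Theorems.ColdBoxAllGroupsDefs
import Summits.QuantumFields.YangMills.Theorems.ColdBoxAllGroupsBulkAllGroupsStubDlrAssemblyG
import Summits.QuantumFields.YangMills.Theorems.ColdBoxAllGroupsBulkAllGroupsStubLargeFieldRarityG
import Summits.QuantumFields.YangMills.Theorems.ColdBoxAllGroupsBulkAllGroupsMeanSmoothOfExpansionG
import Summits.QuantumFields.YangMills.Theorems.ColdBoxAllGroupsBulkAllGroupsCovStableOfExpansionG
import Summits.QuantumFields.YangMills.Theorems.ColdBoxAllGroupsBulkAllGroupsFlatCovOfDomAbsG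
import Summits.QuantumFields.YangMills.Theorems.ColdBoxAllGroupsBulkAllGroupsStubBoxPolyFloorG
import Summits.QuantumFields.YangMills.Theorems.ColdBoxAllGroupsBulkAllGroupsStubBoxDirichletAbsG
import Summits.QuantumFields.YangMills.Theorems.WeakCouplingRatesBulkDominatesColdBoxWStubDirKernelTwoPoint
import Summits.QuantumFields.YangMills.Theorems.WeakCouplingRatesBulkDominatesColdBoxWDirKernelDiagFlat
import Summits.QuantumFields.YangMills.Theorems.BalabanLadderNTOnePointFloor

/-!
# Birth skeleton for crux `BulkAllGroups` (stmt-QuantumFields-22255) of route `ColdBoxAllGroups` — `Lines/dlr-chessboard-G.lean`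

Owner: seat `ym-line-cbag-p2` (prover-ym-line-cbag-p2-g0-0, 2026-08-27).  Template: the `SU(2)` line `dlr-chessboard` of crux
`BulkDominatesColdBoxW` (stmt-QuantumFields-19609; ALL stubs landed, crux proved `BulkDominatesColdBoxW_proof` p490223):
`BulkDominatesColdBoxW_proof` = `stub_dlrAssembly` (L3) applied to L1a (`goodBoundaryCovStable_of_kernelCovExpansion`), L1b
(`goodBoundaryMeanSmooth_of_kernelMeanExpansion`), L2 (`stub_largeFieldRarity`), L4 (`stub_boxPolyFloor` ⇐ BOX_W + FLOOR) along the
family `(A, δ, θ, K) = (θ/20, θ/5, θ, 2 + θ/2)`, `θ = min θ₀ θa θb θk`.  The group enters that proof ONLY through L1a, L1b (one-scale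
expansions of the box kernel around crude-good data in the `SU(2)` gnomonic chart), L2 (one-link Haar small ball — generic:
`haar_ball_ge_of_unitaryRep`) and L4 (BOX); L3 is probability + DLR plumbing.

VERSION v5 (BY NAME): open stubs = N2-cov-G, N2-mean-G only; FLAT-ABS-G and L4-G CLOSED (sibling crux BoxFloorAllGroups PROVED p585759, S2 landed).  The G-generic predicates are the tree's `Theorems/ColdBoxAllGroupsDefs.lean` (p577245 ACCEPTED, commit 5744db979e47,
namespace `Summit.QuantumFields.YangMills.Theorems.ColdBoxAllGroups`); v0 carried local copies.

## Stubs (instance binders `[MeasurableSpace G] [BorelSpace G]` — NOT `letI … :=`, whose `:=` truncates the registered signature; the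
## composition instantiates them at the crux's `borel G`; family `(A, δ, K) = (θ/20, θ/5, 2 + θ/2)`, window `K + 4δ + 2A = 2 + 1.4θ < 2 + 2θ`)
* **N2-cov-G `stub_kernelCovExpansionG`** (LOAD-BEARING, XL): ∀ compact simple `G`, ∀ `r`, ∃ θ₂ > 0, ∀ 0 < θ ≤ θ₂,
  `KernelCovExpansionG r.ρ (θ/20) θ (θ/5)` — one-scale expansion of the deep kernel COVARIANCE around crude-good data in `expChart r.ρ`
  (`SU(2)`: `stub_kernelCovExpansion` ← KernelCovDatumRpow / KernelBridge / NearCentreEdges / DatumPackage …).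
* **FLAT-ABS-G `stub_boxDirichletAbsG`** (XL, SHARED = the conclusion of crux 22254's S2 `stub_boxDirichletDominationAbsG`, instance-binder form):
  `|β²·boxPlaqCov r.ρ β H T − (D/4)·boxDirCircSqCov H T| ≤ β^{−κ}`, `κ > 8θ`, all `T ≤ H`, below a ceiling; N2-flat-G `stub_flatCovExpansionG` is
  DERIVED from it (`stub_flatCovExpansionG_of_domAbsG`, p583404; `SU(2)`: `flatCovExpansion_of_domAbs`).
* **N2-mean-G `stub_kernelMeanExpansionG`** (XL): `KernelMeanExpansionG r.ρ θ (θ/5)` below a ceiling (`SU(2)`: `stub_kernelMeanExpansion` ←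
  KernelMeanTrunk / KernelMeanPrelims / DatumPackage / KernelBridge / ShiftSmall).
* L1a-G `stub_goodBoundaryCovStableG`, L1b-G `stub_goodBoundaryMeanSmoothG` — DERIVED (reductions R1-G p582487 / R2-G p582479 + landed G-free
  N1 `stub_dirKernelTwoPoint` / N1′ `dirKernelDiagFlat`; `dimE ≥ 1`).
* **L2-G `stub_largeFieldRarityG`** — CLOSED (p581275; helper tail p579986): ∀ compact `G`, ∀ `r`, ∀ δ > 0, `PlaquetteLargeFieldRarityG r.ρ δ` —
  chessboard (host tree `WilsonPlaquetteTail.measureReal_plaquette_mem_le`, HS link balls `exists_haar_gball_ge`) + odd-side doubling.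
* **L4-G `stub_boxPolyFloorG`** (S given BOX_G): ∀ compact simple `G`, ∀ `r`, ∃ θk > 0, ∀ 0 < θ ≤ θk, `BoxPolyFloorG r.ρ (θ/20) θ (2 + θ/2)` —
  from the sibling crux `BoxFloorAllGroups` (stmt-QuantumFields-22254) + FLOOR `curvatureCorrPowerFloor_proof` (`8A = 0.4θ < θ/2`).
* **L3-G `stub_dlrAssemblyG : DlrAssemblyG`** — CLOSED (p580082; helper plumbing p579179): port of `stub_dlrAssembly`, constants `2N`, `8N²`.
* `BulkAllGroups_holds_of_stubs` — composition, kernel-checked, concludes the crux BY NAME (uses the stubs by name).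

No summit is proved by this line: the crux is a rung-level finite-volume comparison (R2xi-G `XiPow`, RECORD label); the Yang–Mills
mass gap is NOT proved by any of this.
-/

set_option autoImplicit false

noncomputable section

namespace Summit.QuantumFields.YangMills.Cruxes.BulkAllGroups.Birth

open MeasureTheory Filter Topology
open Literature.MathematicalPhysics Literature.MathematicalPhysics.QuantumFieldTheory
open Literature.MathematicalPhysics.QuantumLattice
open Summit.QuantumFields.YangMills.Theorems.WeakCouplingRates
open Summit.QuantumFields.YangMills.Theses.ColdBoxAllGroups (BulkAllGroups BoxFloorAllGroups)
open Summit.QuantumFields.YangMills.Theorems.ColdBoxAllGroups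
open Summit.QuantumFields.YangMills.Theorems.FreeEnergyLogCoefficient (dimE)

/-! ## The stubs -/

/-- **N2-cov-G (stub, load-bearing)** — the one-scale expansion of the deep kernel COVARIANCE in the exponential chart `expChart r.ρ`,
uniformly over crude-good data, along `(A, δ) = (θ/20, θ/5)` below a ceiling `θ₂(G, r)`: Gaussian value `(D/2)·C_D² + 2β⟨F̄_p,F̄_q⟩C_D`,
error `β^{−θ/2}` (`D = dimE r.ρ`).  `SU(2)` instance: `stub_kernelCovExpansion` (θ₂ = 1/200). -/
theorem stub_kernelCovExpansionG :
    ∀ (G : Type) [Group G] [TopologicalSpace G] [IsTopologicalGroup G] [CompactSpace G] [MeasurableSpace G] [BorelSpace G],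
    IsCompactSimpleLieGroup G → ∀ r : LatticeRep G, ∃ θ₂ : ℝ, 0 < θ₂ ∧ ∀ θ : ℝ, 0 < θ → θ ≤ θ₂ →
      KernelCovExpansionG r.ρ (θ / 20) θ (θ / 5) := by
  sorry

/-- **FLAT-ABS-G — CLOSED** (p587129, from the sibling crux's landed S2 `stub_boxDirichletDominationAbsG` + S1, `subst`-transported).
Originally: **(stub, SHARED with crux 22254)** — the ABSOLUTE one-scale comparison of the cold-wall box with its own temporal-gauge Dirichlet
Gaussian, every compact simple `G` (instance-binder form of the CONCLUSION of the sibling line's S2 `stub_boxDirichletDominationAbsG`, whose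
hypothesis S1 `stub_boxLargeFieldRarityG` is already landed): `∃ θ₀ > 0, ∀ 0 < θ ≤ θ₀, ∃ κ > 8θ`, eventually in `β`, `∀ T ≤ H = ⌈β^θ⌉`,
`|β²·boxPlaqCov r.ρ β H T − (D/4)·boxDirCircSqCov H T| ≤ β^{−κ}`.  `SU(2)` instance: `boxDirichletDominationAbs` (θ₀ = 1/100, κ = 9θ).  When the
lead of 22254 lands S2, this stub is `subst`-derivable from it in ten lines. -/
theorem stub_boxDirichletAbsG :
    ∀ (G : Type) [Group G] [TopologicalSpace G] [IsTopologicalGroup G] [CompactSpace G] [MeasurableSpace G] [BorelSpace G],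
    IsCompactSimpleLieGroup G → ∀ r : LatticeRep G, ∃ θ₀ : ℝ, 0 < θ₀ ∧ ∀ θ : ℝ, 0 < θ → θ ≤ θ₀ → ∃ κ : ℝ, 8 * θ < κ ∧
      ∃ β₀ : ℝ, ∀ β : ℝ, β₀ ≤ β → ∀ T : ℕ, T ≤ ⌈β ^ θ⌉₊ →
        |β ^ 2 * boxPlaqCov r.ρ β ⌈β ^ θ⌉₊ T - (dimE r.ρ : ℝ) / 4 * boxDirCircSqCov ⌈β ^ θ⌉₊ T| ≤ β ^ (-κ) :=
  Summit.QuantumFields.YangMills.Theorems.ColdBoxAllGroups.stub_boxDirichletAbsG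

/-- **N2-flat-G — DERIVED** (reduction `stub_flatCovExpansionG_of_domAbsG`, p583404): the sibling crux BOX_G in Dirichlet dress, for the FLAT datum
`|β²·boxPlaqCov − (D/2)·C_D(p,q)²| ≤ β^{−θ/2}` along `A = θ/20` below a ceiling.  `SU(2)` instance: `stub_flatCovExpansion`. -/
theorem stub_flatCovExpansionG :
    ∀ (G : Type) [Group G] [TopologicalSpace G] [IsTopologicalGroup G] [CompactSpace G] [MeasurableSpace G] [BorelSpace G],
    IsCompactSimpleLieGroup G → ∀ r : LatticeRep G, ∃ θ₃ : ℝ, 0 < θ₃ ∧ ∀ θ : ℝ, 0 < θ → θ ≤ θ₃ →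
      FlatCovExpansionG r.ρ (θ / 20) θ :=
  stub_flatCovExpansionG_of_domAbsG stub_boxDirichletAbsG

/-- **N2-mean-G (stub)** — the one-scale expansion of deep kernel MEANS in the exponential chart, uniformly over crude-good data and over
base points within `H/8` of the centre, along `δ = θ/5` below a ceiling `θ₂(G, r)`: Gaussian value `(D/2)·V_D + β Σ_c F̄_c²`, error `β^{−θ}`.
`SU(2)` instance: `stub_kernelMeanExpansion` (θ₂ = 1/100). -/
theorem stub_kernelMeanExpansionG :
    ∀ (G : Type) [Group G] [TopologicalSpace G] [IsTopologicalGroup G] [CompactSpace G] [MeasurableSpace G] [BorelSpace G],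
    IsCompactSimpleLieGroup G → ∀ r : LatticeRep G, ∃ θ₂ : ℝ, 0 < θ₂ ∧ ∀ θ : ℝ, 0 < θ → θ ≤ θ₂ →
      KernelMeanExpansionG r.ρ θ (θ / 5) := by
  sorry

/-- **L1a-G — DERIVED** (reduction R1-G `goodBoundaryCovStableG_of_kernelCovExpansionG`, p582487; `D ≥ 1` by
`dimE_pos_of_isCompactSimpleLieGroup`; N1 = landed `stub_dirKernelTwoPoint`): from N2-cov-G and N2-flat-G. -/
theorem stub_goodBoundaryCovStableG :
    ∀ (G : Type) [Group G] [TopologicalSpace G] [IsTopologicalGroup G] [CompactSpace G] [MeasurableSpace G] [BorelSpace G],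
    IsCompactSimpleLieGroup G → ∀ r : LatticeRep G, ∃ θa : ℝ, 0 < θa ∧ ∀ θ : ℝ, 0 < θ → θ ≤ θa → ∃ η₁ : ℝ, 0 < η₁ ∧
      GoodBoundaryCovStableG r.ρ (θ / 20) θ (θ / 5) η₁ :=
  fun G _ _ _ _ _ _ hG r =>
    goodBoundaryCovStableG_of_kernelCovExpansionG r.ρ
      (Nat.succ_le_of_lt (Summit.QuantumFields.YangMills.Cruxes.NT.LinkEquipartition.dimE_pos_of_isCompactSimpleLieGroup G r hG))
      (stub_kernelCovExpansionG G hG r) (stub_flatCovExpansionG G hG r) stub_dirKernelTwoPoint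

/-- **L1b-G — DERIVED** (reduction R2-G `goodBoundaryMeanSmoothG_of_kernelMeanExpansionG`, p582479; N1′ = landed `dirKernelDiagFlat`):
from N2-mean-G. -/
theorem stub_goodBoundaryMeanSmoothG :
    ∀ (G : Type) [Group G] [TopologicalSpace G] [IsTopologicalGroup G] [CompactSpace G] [MeasurableSpace G] [BorelSpace G],
    IsCompactSimpleLieGroup G → ∀ r : LatticeRep G, ∃ θb : ℝ, 0 < θb ∧ ∀ θ : ℝ, 0 < θ → θ ≤ θb →
      GoodBoundaryMeanSmoothG r.ρ (θ / 20) θ (θ / 5) :=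
  fun G _ _ _ _ _ _ hG r => goodBoundaryMeanSmoothG_of_kernelMeanExpansionG r.ρ (stub_kernelMeanExpansionG G hG r) dirKernelDiagFlat

/-- **L2-G — CLOSED** (p581275, `Theorems/ColdBoxAllGroupsBulkAllGroupsStubLargeFieldRarityG.lean`; helper tail p579986): the landed
tree theorem BY NAME. -/
theorem stub_largeFieldRarityG :
    ∀ (G : Type) [Group G] [TopologicalSpace G] [IsTopologicalGroup G] [CompactSpace G] [MeasurableSpace G] [BorelSpace G]
      (r : LatticeRep G) (δ : ℝ), 0 < δ → PlaquetteLargeFieldRarityG r.ρ δ :=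
  Summit.QuantumFields.YangMills.Theorems.ColdBoxAllGroups.stub_largeFieldRarityG

/-- **L4-G — CLOSED** (p587071: `BoxFloorAllGroups_proof` p585759 + `stub_boxPolyFloorG_of_boxFloorAllGroups'`). -/
theorem stub_boxPolyFloorG :
    ∀ (G : Type) [Group G] [TopologicalSpace G] [IsTopologicalGroup G] [CompactSpace G] [MeasurableSpace G] [BorelSpace G],
    IsCompactSimpleLieGroup G → ∀ r : LatticeRep G, ∃ θk : ℝ, 0 < θk ∧ ∀ θ : ℝ, 0 < θ → θ ≤ θk →
      BoxPolyFloorG r.ρ (θ / 20) θ (2 + θ / 2) :=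
  Summit.QuantumFields.YangMills.Theorems.ColdBoxAllGroups.stub_boxPolyFloorG

/-- **L3-G — CLOSED** (p580082, `Theorems/ColdBoxAllGroupsBulkAllGroupsStubDlrAssemblyG.lean`): the landed tree theorem BY NAME. -/
theorem stub_dlrAssemblyG : DlrAssemblyG :=
  Summit.QuantumFields.YangMills.Theorems.ColdBoxAllGroups.stub_dlrAssemblyG

/-! ## Composition (kernel-checked): (N2-cov-G ∧ N2-flat-G ⇒ L1a-G) ∧ (N2-mean-G ⇒ L1b-G) ∧ L2-G ∧ L4-G assembled by L3-G ⇒ the crux BY NAME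

(The composition USES the five stubs by name — the skeleton audit admits no other `Prop` hypotheses; an earlier two-theorem form
`BulkAllGroups_of (h1a) … (h3)` + `…_holds_of_stubs` is equivalent but trips `skeleton.extra-hypothesis` when the audit picks the
parametric theorem first.) -/

/-- **The crux BY NAME from the five stubs**: `θ = min θ₀ θa θb θk`, `(A, δ, K) = (θ/20, θ/5, 2 + θ/2)`, L3-G applied to L1a-G, L1b-G,
L2-G (at `δ = θ/5`), L4-G — verbatim the `SU(2)` composition `BulkDominatesColdBoxW_proof`. -/
theorem BulkAllGroups_holds_of_stubs : BulkAllGroups := by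
  intro G _ _ _ _ hG
  letI : MeasurableSpace G := borel G
  haveI : BorelSpace G := ⟨rfl⟩
  intro r θ₀ hθ₀
  obtain ⟨θa, hθa, ha⟩ := stub_goodBoundaryCovStableG G hG r
  obtain ⟨θb, hθb, hb⟩ := stub_goodBoundaryMeanSmoothG G hG r
  obtain ⟨θk, hθk, hk⟩ := stub_boxPolyFloorG G hG r
  set θ : ℝ := min θ₀ (min θa (min θb θk)) with hθdef
  have hθpos : 0 < θ := lt_min hθ₀ (lt_min hθa (lt_min hθb hθk))
  have hθ0 : θ ≤ θ₀ := min_le_left _ _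
  have hθa' : θ ≤ θa := le_trans (min_le_right _ _) (min_le_left _ _)
  have hθb' : θ ≤ θb := le_trans (min_le_right _ _) (le_trans (min_le_right _ _) (min_le_left _ _))
  have hθk' : θ ≤ θk := le_trans (min_le_right _ _) (le_trans (min_le_right _ _) (min_le_right _ _))
  obtain ⟨η₁, hη, h1a'⟩ := ha θ hθpos hθa'
  refine ⟨θ / 20, θ, by positivity, by linarith, hθ0, ?_⟩
  exact stub_dlrAssemblyG G r (θ / 20) θ (θ / 5) η₁ (2 + θ / 2) (by positivity) (by positivity) hη (by linarith) h1a'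
    (hb θ hθpos hθb') (stub_largeFieldRarityG G r (θ / 5) (by positivity)) (hk θ hθpos hθk')

end Summit.QuantumFields.YangMills.Cruxes.BulkAllGroups.Birth

end
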